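import Mathlib.ModelTheory.Ultraproducts
import Mathlib.Order.Filter.Ultrafilter.Basic
import Mathlib.ModelTheory.Algebra.Field.CharP
import Literature.ModelTheory.PseudofiniteFields.UniformBound

/-!
# Uniform bounds over fields with a prescribed theory; characteristic-zero pseudo-finite fields

Let `χ₀, χ₁, χ₂, …` be formulas of the language of rings in free variables `α`, and let `T` be
any set of ring sentences. If in every field `K` with `K ⊨ T` every tuple `v : α → K` satisfies
*some* `χ_N`, then one `N` works uniformly: every tuple of every field `K ⊨ T` satisfies some
`χ_n` with `n ≤ N` (`exists_uniform_bound_of_model`). This is the compactness theorem, in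
the form "a first-order bound that is finite at every tuple of every model is uniform"; it is
the general version of `FiniteField.exists_uniform_bound_of_pseudoFinite`
(file `UniformBound.lean`, the case `T = finiteFieldTheory ∪ infiniteTheory`).

The instance recorded here for use around [ChatzidakisVanDenDriesMacintyre1992, Prop. (2.7)]
along `char F → ∞` is the one for **pseudo-finite fields of characteristic zero**
(`FiniteField.exists_uniform_bound_of_pseudoFinite_charZero`): fields `K` with `[CharZero K]`
and `K ⊨ finiteFieldTheory`, i.e. `T = finiteFieldTheory ∪ Theory.fieldOfChar 0` (Mathlib's
`FirstOrder.Language.Theory.fieldOfChar 0` = field axioms + `¬ (p = 0)` for all primes `p`;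
`FirstOrder.Field.charP_iff_model_fieldOfChar`). Such a field is infinite, so this is a class of
pseudo-finite fields.

Proof (ultraproducts, exactly as in `UniformBound.lean`). If no `N` works, pick for each `N` a
field `K_N ⊨ T` and a tuple `v_N` falsifying `χ_0, …, χ_N`. The ultraproduct `M = ∏_u K_N` along
a non-principal ultrafilter `u` on `ℕ` is a model of `T` and of the field axioms (Łoś, sentence
by sentence: `model_ultraproduct_of_forall_model`), hence — made into a field by Mathlib's
`fieldOfModelField` / `compatibleRingOfModelField` — a field `⊨ T`; so the tuple `(v_N)_u`
satisfies some `χ_{N₀}` in `M`, hence (Łoś for formulas with parameters,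
`Ultraproduct.realize_formula_cast`) `v_N` satisfies `χ_{N₀}` in `K_N` for `u`-almost all `N`,
in particular for some `N ≥ N₀` — a contradiction (`exists_le_realize_seq_of_model`).

No monotonicity of `χ_N` in `N` is assumed (accordingly the conclusion reads `∃ n ≤ N, χ_n`),
and the variable type `α` is arbitrary. All fields are taken in `Type`, presented as
`[Field K] [CompatibleRing K]`, the form in which algebra applies to them.

## References

* [ChatzidakisVanDenDriesMacintyre1992] Z. Chatzidakis, L. van den Dries, A. Macintyre,
  Definable sets over finite fields, J. reine angew. Math. 427 (1992) 107–135, p. 110, (2.7)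
  (the compactness steps "by pure logic").
-/

namespace Literature.ModelTheory.PseudofiniteFields

open FirstOrder FirstOrder.Language FirstOrder.Ring FirstOrder.Field Filter
open scoped FirstOrder

/-- A property assumed of all tuples of all *fields* `K ⊨ T` (`[Field K] [CompatibleRing K]`)
holds of all tuples of every `Language.ring`-*structure* that is a model of the field axioms and
of `T`: Mathlib's `fieldOfModelField` / `compatibleRingOfModelField` make such a structure a
field with the given ring structure. (Instance bookkeeping only.) [folklore] -/
theorem exists_realize_of_model_field {α : Type} {T : Language.ring.Theory}
    (χ : ℕ → Language.ring.Formula α)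
    (h : ∀ (K : Type) [_root_.Field K] [CompatibleRing K], K ⊨ T →
      ∀ v : α → K, ∃ N, (χ N).Realize v)
    (M : Type) [Language.ring.Structure M] [M ⊨ FirstOrder.Language.Theory.field] (hM : M ⊨ T)
    (x : α → M) : ∃ N, (χ N).Realize x := by
  letI : _root_.Field M := fieldOfModelField M
  letI : CompatibleRing M := compatibleRingOfModelField M
  exact h M hM x

/-- **The ultraproduct step.** If every tuple of every field `K ⊨ T` satisfies some `χ_N`, then
for ANY sequence of fields `K_N ⊨ T` (`N ∈ ℕ`) with tuples `v_N : α → K_N`, some `v_N`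
satisfies some `χ_{N₀}` with `N₀ ≤ N`. Proof: the ultraproduct `∏_u K_N` (`u` non-principal) is
a model of `T` and of the field axioms (Łoś), so its diagonal tuple satisfies some `χ_{N₀}`; by
Łoś so does `v_N` for `u`-almost all `N`, and `{N | N₀ ≤ N} ∈ u`. [folklore] -/
theorem exists_le_realize_seq_of_model {α : Type} {T : Language.ring.Theory}
    (χ : ℕ → Language.ring.Formula α)
    (h : ∀ (K : Type) [_root_.Field K] [CompatibleRing K], K ⊨ T →
      ∀ v : α → K, ∃ N, (χ N).Realize v)
    (K : ℕ → Type) [∀ N, _root_.Field (K N)] [∀ N, CompatibleRing (K N)]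
    (hK : ∀ N, K N ⊨ T) (v : ∀ N, α → K N) :
    ∃ N₀ N, N₀ ≤ N ∧ (χ N₀).Realize (v N) := by
  -- the ultraproduct along the non-principal ultrafilter `hyperfilter ℕ` is a model of `T` ...
  have hM : ((hyperfilter ℕ : Ultrafilter ℕ) : Filter ℕ).Product K ⊨ T :=
    model_ultraproduct_of_forall_model hK
  -- ... and of the field axioms
  haveI hMF : ((hyperfilter ℕ : Ultrafilter ℕ) : Filter ℕ).Product K ⊨
      FirstOrder.Language.Theory.field :=
    model_ultraproduct_of_forall_model fun N => (inferInstance : K N ⊨ Theory.field)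
  -- so its diagonal tuple `(v_N)_u` satisfies some `χ_{N₀}` ...
  obtain ⟨N₀, hN₀⟩ := exists_realize_of_model_field χ h _ hM fun a =>
    ((fun N => v N a : ∀ N, K N) : ((hyperfilter ℕ : Ultrafilter ℕ) : Filter ℕ).Product K)
  -- ... hence (Łoś) `v_N` satisfies `χ_{N₀}` in `K_N` for almost all `N`, in particular for
  -- some `N ≥ N₀`
  have hlos : ∀ᶠ N in ((hyperfilter ℕ : Ultrafilter ℕ) : Filter ℕ), (χ N₀).Realize (v N) :=
    (Ultraproduct.realize_formula_cast (χ N₀) (fun a N => v N a)).1 hN₀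
  have hge : ∀ᶠ N in ((hyperfilter ℕ : Ultrafilter ℕ) : Filter ℕ), N₀ ≤ N :=
    Nat.hyperfilter_le_atTop (eventually_ge_atTop N₀)
  obtain ⟨N, hN₀N, hN⟩ := (hge.and hlos).exists
  exact ⟨N₀, N, hN₀N, hN⟩

/-- **Uniform bounds over the fields satisfying a theory (compactness).** If `χ_N` (`N ∈ ℕ`)
are ring formulas in the free variables `α`, `T` is a set of ring sentences, and in every field
`K ⊨ T` every tuple `v : α → K` satisfies some `χ_N`, then there is one `N` such that every
tuple of every field `K ⊨ T` satisfies some `χ_n` with `n ≤ N`. [folklore] compactness: a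
first-order bound finite at every tuple of every model is uniform (proved through the
ultraproduct `∏_u K_N` of counterexamples and Łoś's theorem, `exists_le_realize_seq_of_model`). -/
theorem exists_uniform_bound_of_model {α : Type} (T : Language.ring.Theory)
    (χ : ℕ → Language.ring.Formula α)
    (h : ∀ (K : Type) [_root_.Field K] [CompatibleRing K], K ⊨ T →
      ∀ v : α → K, ∃ N, (χ N).Realize v) :
    ∃ N, ∀ (K : Type) [_root_.Field K] [CompatibleRing K], K ⊨ T →
      ∀ v : α → K, ∃ n ≤ N, (χ n).Realize v := by
  by_contra hcon
  push Not at hcon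
  -- for each `N` a field `K_N ⊨ T` and a tuple `v_N` falsifying `χ_0, …, χ_N`
  choose K instF instCR hK v hv using hcon
  obtain ⟨N₀, N, hN₀N, hN⟩ := exists_le_realize_seq_of_model χ h K hK v
  exact hv N N₀ hN₀N hN

namespace FiniteField

/-- A field of characteristic zero satisfying the theory of finite fields is a model of
`finiteFieldTheory ∪ Theory.fieldOfChar 0`, and conversely such a model (a field) has
characteristic zero (Mathlib's `charP_iff_model_fieldOfChar`). [folklore] -/
theorem model_union_fieldOfChar_zero_iff (K : Type*) [_root_.Field K] [CompatibleRing K] :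
    K ⊨ finiteFieldTheory ∪ FirstOrder.Language.Theory.fieldOfChar 0 ↔
      K ⊨ finiteFieldTheory ∧ CharZero K := by
  rw [Theory.model_union_iff, charP_iff_model_fieldOfChar]
  exact and_congr_right fun _ => ⟨fun _ => CharP.charP_to_charZero K, fun _ => CharP.ofCharZero K⟩

/-- **Uniform bounds over pseudo-finite fields of characteristic zero.** If `χ_N` (`N ∈ ℕ`) are
ring formulas in the free variables `α` and in every characteristic-zero field `K` satisfying
all sentences true in all finite fields (`[CharZero K]`, `K ⊨ finiteFieldTheory`; these are
pseudo-finite fields) every tuple `v : α → K` satisfies some `χ_N`, then there is one `N` such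
that every tuple of every such field satisfies some `χ_n` with `n ≤ N`. [folklore] compactness
(`exists_uniform_bound_of_model` for `T = finiteFieldTheory ∪ Theory.fieldOfChar 0`: the
ultraproduct of characteristic-zero pseudo-finite fields is one, by Łoś's theorem); the
characteristic-zero analogue of `FiniteField.exists_uniform_bound_of_pseudoFinite`, used along
`char F → ∞` around [ChatzidakisVanDenDriesMacintyre1992, (2.7)]. -/
theorem exists_uniform_bound_of_pseudoFinite_charZero {α : Type}
    (χ : ℕ → Language.ring.Formula α)
    (h : ∀ (K : Type) [_root_.Field K] [CompatibleRing K] [CharZero K], K ⊨ finiteFieldTheory →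
      ∀ v : α → K, ∃ N, (χ N).Realize v) :
    ∃ N, ∀ (K : Type) [_root_.Field K] [CompatibleRing K] [CharZero K], K ⊨ finiteFieldTheory →
      ∀ v : α → K, ∃ n ≤ N, (χ n).Realize v := by
  obtain ⟨N, hN⟩ := exists_uniform_bound_of_model
    (finiteFieldTheory ∪ FirstOrder.Language.Theory.fieldOfChar 0) χ fun K _ _ hK => by
      obtain ⟨hK1, hK2⟩ := (model_union_fieldOfChar_zero_iff K).1 hK
      haveI := hK2
      exact h K hK1
  exact ⟨N, fun K _ _ _ hK => hN K ((model_union_fieldOfChar_zero_iff K).2 ⟨hK, inferInstance⟩)⟩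

end FiniteField

end Literature.ModelTheory.PseudofiniteFields
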